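/-
Copyright (c) 2026 the pub-hodgecm-mathlib formalisation cell (harness21).  Prover seat hodgecm-mathlib-K2E1-p15 (g0), Track B ∕ K2-LIT «5Res (b) BL-2(χ,τ)», h413 =
`stmt-HodgeConjecture-24833`, line `K2_E1_TraceFormulaBeta`, route of record `HCCMUnconditional`; deal (96) of dealer K2E1-plan (g6) 2026-09-04T10:49:17Z = SHEET
`K2/K2-defs1/g6/SHEET-5Res-b-chi-twins.K2-defs1-g6.md` (92b23bd09c855a21) ROW 2; REPORT-FIRST `K2/STATUS.md` 10:58Z.
-/
import Summits.HodgeConjecture.HodgeConjecture.Theorems.K2E1CharacterEisensteinU2Defs       -- ★ p859441 (K2-defs1 g6): `IsChiSection`, `HasReflectedIntertwining`, `flatSectionU_toAdelic_mul_of_isChiSection`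
import Summits.HodgeConjecture.HodgeConjecture.Theorems.K2E1EisensteinAnalyticBinders        -- ★ (K2E1-p09): `hfin_of_locallyUniformMajorant`; brings ★ CT `borelConstantTerm_eisensteinSeriesU_two`
import Summits.HodgeConjecture.HodgeConjecture.Theorems.K2E1BorelEisensteinGodementCMTwo      -- ★ (K2E1-p09): `exists_locallyUniform_majorant_flatSectionU_cm_two` (bounded `φ`, `1 < Re z`)
import Summits.HodgeConjecture.HodgeConjecture.Theorems.K2E1UnipotentHaarNormalisationU2     -- ★ `isInvInvariant_of_isHaarMeasure_two`
import Literature.NumberTheory.Automorphic.UnitaryGroupUnipotentUnimodularThree              -- ★ `measure_ne_zero_of_isFundamentalDomain_rationalUnipotent`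
import HarnessLib

/-!
# K2·E1 — `K2E1ChiEisensteinConstantTermCMTwo`: THE BOREL CONSTANT TERM OF THE `χ`-EISENSTEIN SERIES OF `U(1,1)_{L∕L⁺}` ON THE HALF-PLANE OF CONVERGENCE,
# `E_B(f_z)(g) = f_z(g) + (ν𝓕)⁻¹ · ∫_{N(𝔸)} f_z(w₀ v g) dν(v)` (`1 < Re z`) — the `(χ, τ)` twin of ★ `borelConstantTerm_sphericalEisenstein_cm_two`

Track B ∕ K2-LIT, crux h413 = `stmt-HodgeConjecture-24833`; cell `hodgecm-mathlib`, squad K2, ENGINE E1, campaign «5Res», road of record «BL-2(χ,τ) ∘ MS-2(χ,τ) ∘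
ARCH-UNITARITY ∘ R8₂» (census K2E4-p23 (g2), TABLE 12th issue §F).  THEOREMS ONLY (no `def`, no `instance`, no notation, no named-fact hypothesis, no `sorry`); lane
`--kind proof --supports stmt-HodgeConjecture-24833 --as helper` (count-neutral).  Closes no socket.

WHAT CHANGES WITH `(χ, τ)`.  The spherical file ★ `K2E1SphericalEisensteinContinuationU2Final.borelConstantTerm_sphericalEisenstein_cm_two` hard-wires the constant section
`φ = fun _ => φ₀` and closes with the SCALAR `c(z)` of ★ (R6k)₂ `intertwinedCoeff_const`.  For a `χ`-section `φ` (`IsChiSection χ φ`, ★ p859441: `φ(b g) = χ(b₀₀)·φ(g)`, `b ∈ B(𝔸)`)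
with a `K_∞`-type and finite level, `M(z, χ)` is an OPERATOR and the reflected term lives in `I(χʷ)`; so this file stops one step earlier, at the Bruhat-unfolded constant term with
the big-cell integral left as an integral (§1–§2), and reads it against the statement-only shape ★ `HasReflectedIntertwining χ ν φ φ′ z` («`M(z,χ)φ = φ′`») in §3:
`E_B(f_z) = f_z + (ν𝓕)⁻¹ • f′_{1−z}`.  Everything upstream is section-generic (SHEET rule of thumb): ★ CT `K2E1EisensteinSeriesLeftRight.borelConstantTerm_eisensteinSeriesU_two`
(binders: `f` Borel, left-`N(𝔸)`- and left-`B(F)`-invariant, `ν` left- and inversion-invariant, `0 < ν(𝓕) < ∞`, Godement finiteness `hfin` at `g`), ★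
`K2E1EisensteinAnalyticBinders.hfin_of_locallyUniformMajorant` and the UNCONDITIONAL CM majorant ★ `K2E1BorelEisensteinGodementCMTwo.exists_locallyUniform_majorant_flatSectionU_cm_two`
(`‖φ‖ ≤ M`, `1 < Re z`).  `χ` need not be unitary here (only `‖φ‖ ≤ M` enters).

* §1 `borelConstantTerm_eisensteinSeriesU_flatSectionU_cm_two` — SECTION-GENERIC: `φ` continuous, bounded, left-`N(𝔸_{L⁺})`- and left-`B(L⁺)`-invariant, `1 < Re z`.
* §2 `borelConstantTerm_chiEisenstein_cm_two` — the `χ`-TWIN: `IsChiSection χ φ`, `φ` continuous and bounded (★ `IsChiSection.unipotent_mul ∕ .toAdelic_mul` feed §1).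
* §3 `borelConstantTerm_chiEisenstein_cm_two_of_hasReflectedIntertwining` — with «`M(z,χ)φ = φ′`»: `E_B(f_z)(g) = f_z(g) + (ν𝓕)⁻¹ • f′_{1−z}(g)`, and its `ℂ`-linear spelling
  `_eq_add_mul`.

HONEST LABEL: HC_CM is proved only modulo the 7 printed citations (2 remaining named inputs: hLiu418 = `stmt-HodgeConjecture-24832`, h413 = `stmt-HodgeConjecture-24833`) until rung 0
closes; this file asserts no named fact and closes no socket.

## References
* [MoeglinWaldspurger1995] C. Mœglin, J.-L. Waldspurger, *Spectral decomposition and Eisenstein series* (1995), II.1.5 (convergence), II.1.7 (constant terms of Eisenstein series, `E_P = Σ_w M(w)φ`).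
* [Garrett2018] P. Garrett, *Modern Analysis of Automorphic Forms by Example* 1 (2018), §2.8 (constant term `c_P E = φ + c(s)φ^w` via the Bruhat decomposition), §3.10.
* [GelbartRogawski1991] S. Gelbart, J. Rogawski, *L-functions and Fourier–Jacobi coefficients for the unitary group U(3)*, Invent. Math. 105 (1991), §3.1 (`U(1,1)`, `I(χ, s)`, `M(s)`).
-/

set_option autoImplicit false
-- the mandated namespace repeats the single-problem summit's segment (`HodgeConjecture.HodgeConjecture`)
set_option linter.dupNamespace false

noncomputable section

open MeasureTheory Measure NumberField IsDedekindDomain Set Filter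
open scoped ENNReal NNReal Topology
open Literature.NumberTheory.Automorphic Literature.NumberTheory.Automorphic.UnitaryGroup AdelicGroupData
open Literature.NumberTheory.GaloisRepresentations (HeckeCharacter)
open Summit.HodgeConjecture.HodgeConjecture.Cruxes.H413.K2E1BorelEisensteinU
open Summit.HodgeConjecture.HodgeConjecture.Cruxes.H413.K2E1CharacterEisensteinU2Defs
open Summit.HodgeConjecture.HodgeConjecture.Cruxes.H413.K2E1EisensteinSeriesLeftRight (borelConstantTerm_eisensteinSeriesU_two)
open Summit.HodgeConjecture.HodgeConjecture.Cruxes.H413.K2E1EisensteinAnalyticBinders (hfin_of_locallyUniformMajorant)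
open Summit.HodgeConjecture.HodgeConjecture.Cruxes.H413.K2E1BorelEisensteinGodementCMTwo (exists_locallyUniform_majorant_flatSectionU_cm_two)
open Summit.HodgeConjecture.HodgeConjecture.Cruxes.H413.K2E1UnipotentHaarNormalisationU2 (isInvInvariant_of_isHaarMeasure_two)

namespace Summit.HodgeConjecture.HodgeConjecture.Cruxes.H413.K2E1ChiEisensteinConstantTermCMTwo

variable (L : Type) [Field L] [NumberField L] [IsCMField L]
variable [MeasurableSpace (quasiSplit (↥(maximalRealSubfield L)) L (IsCMField.complexConj L) 2).Adelic] [BorelSpace (quasiSplit (↥(maximalRealSubfield L)) L (IsCMField.complexConj L) 2).Adelic]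

/-! ## §1 Section-generic: `E_B(f_z)(g) = f_z(g) + (ν𝓕)⁻¹ · ∫_{N(𝔸)} f_z(w₀ v g) dν` for bounded continuous `φ` left-invariant under `N(𝔸)` and `B(L⁺)` -/

/-- **THE BOREL CONSTANT TERM OF `E(φH^z)` ON `Re z > 1`, SECTION-GENERIC, at the CM pair `(L⁺, L)`**: for a Haar measure `ν` of `N(𝔸_{L⁺})`, a fundamental domain `𝓕` of `N(L⁺)` with
compact closure, a CONTINUOUS BOUNDED `φ : U(J₂)(𝔸) → ℂ` (`‖φ‖ ≤ M`) that is left-`N(𝔸_{L⁺})`- and left-`B(L⁺)`-invariant, `1 < Re z` and every `g`: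
`E(f_z)_B(g) = f_z(g) + (ν𝓕)⁻¹ · ∫_{N(𝔸)} f_z(w₀ v g) dν(v)`, `f_z = flatSectionU φ z = φ·H^z` — ★ CT `borelConstantTerm_eisensteinSeriesU_two` with its Godement binder `hfin` discharged by
★ `hfin_of_locallyUniformMajorant` ∘ ★ `exists_locallyUniform_majorant_flatSectionU_cm_two` (the majorant `M·Σ H(γ̃ ·)^{Re z}`), `ν` inversion-invariant ★, `0 < ν(𝓕) < ∞` ★.
[cite: MoeglinWaldspurger1995, II.1.7] [cite: Garrett2018, §2.8] -/
theorem borelConstantTerm_eisensteinSeriesU_flatSectionU_cm_two (ν : Measure ↥(adelicUnipotent (↥(maximalRealSubfield L)) L (IsCMField.complexConj L) 2)) [ν.IsHaarMeasure]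
    {𝓕 : Set ↥(adelicUnipotent (↥(maximalRealSubfield L)) L (IsCMField.complexConj L) 2)} (h𝓕N : IsFundamentalDomain ↥(rationalUnipotent (↥(maximalRealSubfield L)) L (IsCMField.complexConj L) 2) 𝓕 ν) (h𝓕c : IsCompact (closure 𝓕))
    {φ : (quasiSplit (↥(maximalRealSubfield L)) L (IsCMField.complexConj L) 2).Adelic → ℂ} (hφc : Continuous φ) {M : ℝ} (hφM : ∀ x, ‖φ x‖ ≤ M)
    (hφN : ∀ (n : ↥(adelicUnipotent (↥(maximalRealSubfield L)) L (IsCMField.complexConj L) 2)) (y : (quasiSplit (↥(maximalRealSubfield L)) L (IsCMField.complexConj L) 2).Adelic),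
      φ ((n : (quasiSplit (↥(maximalRealSubfield L)) L (IsCMField.complexConj L) 2).Adelic) * y) = φ y)
    (hφB : ∀ b ∈ borelU ((IsCMField.complexConj L : L ≃ₐ[↥(maximalRealSubfield L)] L) : L →+* L) ((StdForm.antidiagonal 2).over L), ∀ x : (quasiSplit (↥(maximalRealSubfield L)) L (IsCMField.complexConj L) 2).Adelic,
      φ ((quasiSplit (↥(maximalRealSubfield L)) L (IsCMField.complexConj L) 2).toAdelic b * x) = φ x)
    {z : ℂ} (hz : 1 < z.re) (g : (quasiSplit (↥(maximalRealSubfield L)) L (IsCMField.complexConj L) 2).Adelic) :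
    borelConstantTerm ν 𝓕 (eisensteinSeriesU (flatSectionU φ z)) g =
      flatSectionU φ z g + ((ν 𝓕).toReal⁻¹ : ℝ) • ∫ v : ↥(adelicUnipotent (↥(maximalRealSubfield L)) L (IsCMField.complexConj L) 2),
        flatSectionU φ z ((quasiSplit (↥(maximalRealSubfield L)) L (IsCMField.complexConj L) 2).toAdelic (weylLongU ((IsCMField.complexConj L : L ≃ₐ[↥(maximalRealSubfield L)] L) : L →+* L) (rfl : (StdForm.antidiagonal 2).over L = (StdForm.antidiagonal 2).over L)) *
          (v : (quasiSplit (↥(maximalRealSubfield L)) L (IsCMField.complexConj L) 2).Adelic) * g) ∂ν := by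
  haveI := t2Space_adeleRing_of_numberField L
  haveI := locallyCompactSpace_adeleRing' L
  haveI : T2Space (quasiSplit (↥(maximalRealSubfield L)) L (IsCMField.complexConj L) 2).Adelic := inferInstanceAs (T2Space (adelic (↥(maximalRealSubfield L)) L (IsCMField.complexConj L) 2 ((StdForm.antidiagonal 2).over L)))
  haveI : ν.IsInvInvariant := isInvInvariant_of_isHaarMeasure_two ν
  have h𝓕₀ : ν 𝓕 ≠ 0 := measure_ne_zero_of_isFundamentalDomain_rationalUnipotent ν h𝓕N
  have h𝓕top : ν 𝓕 ≠ ∞ := ((measure_mono subset_closure).trans_lt h𝓕c.measure_lt_top).ne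
  -- the flat section: Borel (indeed continuous), left-`N(𝔸)`- and `B(L⁺)`-invariant, Godement-finite at `g`
  have hfm : Measurable (flatSectionU φ z) := (continuous_flatSectionU hφc z).measurable
  have hfN : ∀ (n : ↥(adelicUnipotent (↥(maximalRealSubfield L)) L (IsCMField.complexConj L) 2)) (y : (quasiSplit (↥(maximalRealSubfield L)) L (IsCMField.complexConj L) 2).Adelic),
      flatSectionU φ z ((n : (quasiSplit (↥(maximalRealSubfield L)) L (IsCMField.complexConj L) 2).Adelic) * y) = flatSectionU φ z y := fun n y => by
    rw [flatSectionU_apply, flatSectionU_apply, hφN n y, borelHeight_unipotent_mul n.2 y]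
  have hfB := flatSectionU_toAdelic_mul hφB z
  have hfin := hfin_of_locallyUniformMajorant ν hfB (fun q => (continuous_flatSectionU hφc z).comp (continuous_const.mul continuous_id))
    (exists_locallyUniform_majorant_flatSectionU_cm_two L hz (φ := φ) (M := M) hφM) h𝓕c g
  exact borelConstantTerm_eisensteinSeriesU_two ν hfm hfN hfB h𝓕N h𝓕₀ h𝓕top g hfin

/-! ## §2 The `χ`-twin: `χ`-sections -/

/-- **THE BOREL CONSTANT TERM OF THE `χ`-EISENSTEIN SERIES `E(χ, z) = E(φH^z)` ON `Re z > 1`** at the CM pair `(L⁺, L)`: for a Hecke character `χ` of `L`, a CONTINUOUS BOUNDED `χ`-SECTION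
`φ` (`IsChiSection χ φ`: `φ(b g) = χ(b₀₀)·φ(g)` for `b ∈ B(𝔸_{L⁺})`, ★ p859441), a Haar measure `ν` of `N(𝔸_{L⁺})`, a fundamental domain `𝓕` of `N(L⁺)` with compact closure, `1 < Re z`, every `g`:
`E(f_z)_B(g) = f_z(g) + (ν𝓕)⁻¹ · ∫_{N(𝔸)} f_z(w₀ v g) dν(v)` — §1, the invariances being ★ `IsChiSection.unipotent_mul` (`u₀₀ = 1`) and ★ `IsChiSection.toAdelic_mul` (`χ` trivial on principal
ideles).  The second summand is the (un-normalised) intertwining integral `M(w₀, z)f_z(g)`; no scalar `c(z)` is extracted (for `(χ, τ)` it is an operator, SHEET row 3). [cite: MoeglinWaldspurger1995, II.1.7]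
[cite: GelbartRogawski1991, §3.1] [cite: Garrett2018, §2.8] -/
theorem borelConstantTerm_chiEisenstein_cm_two (ν : Measure ↥(adelicUnipotent (↥(maximalRealSubfield L)) L (IsCMField.complexConj L) 2)) [ν.IsHaarMeasure]
    {𝓕 : Set ↥(adelicUnipotent (↥(maximalRealSubfield L)) L (IsCMField.complexConj L) 2)} (h𝓕N : IsFundamentalDomain ↥(rationalUnipotent (↥(maximalRealSubfield L)) L (IsCMField.complexConj L) 2) 𝓕 ν) (h𝓕c : IsCompact (closure 𝓕))
    {χ : HeckeCharacter L} {φ : (quasiSplit (↥(maximalRealSubfield L)) L (IsCMField.complexConj L) 2).Adelic → ℂ} (hφ : IsChiSection χ φ) (hφc : Continuous φ) {M : ℝ} (hφM : ∀ x, ‖φ x‖ ≤ M)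
    {z : ℂ} (hz : 1 < z.re) (g : (quasiSplit (↥(maximalRealSubfield L)) L (IsCMField.complexConj L) 2).Adelic) :
    borelConstantTerm ν 𝓕 (eisensteinSeriesU (flatSectionU φ z)) g =
      flatSectionU φ z g + ((ν 𝓕).toReal⁻¹ : ℝ) • ∫ v : ↥(adelicUnipotent (↥(maximalRealSubfield L)) L (IsCMField.complexConj L) 2),
        flatSectionU φ z ((quasiSplit (↥(maximalRealSubfield L)) L (IsCMField.complexConj L) 2).toAdelic (weylLongU ((IsCMField.complexConj L : L ≃ₐ[↥(maximalRealSubfield L)] L) : L →+* L) (rfl : (StdForm.antidiagonal 2).over L = (StdForm.antidiagonal 2).over L)) *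
          (v : (quasiSplit (↥(maximalRealSubfield L)) L (IsCMField.complexConj L) 2).Adelic) * g) ∂ν :=
  borelConstantTerm_eisensteinSeriesU_flatSectionU_cm_two L ν h𝓕N h𝓕c hφc hφM hφ.unipotent_mul hφ.toAdelic_mul hz g

/-! ## §3 With the reflected section «`M(z, χ)φ = φ′`»: `E_B(f_z) = f_z + (ν𝓕)⁻¹ • f′_{1−z}` -/

/-- **`E_B(f_z)(g) = f_z(g) + (ν𝓕)⁻¹ • f′_{1−z}(g)`** on `Re z > 1` at the CM pair: §2 read against the statement-only shape ★ `HasReflectedIntertwining χ ν φ φ′ z` of the DEFS leaf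
(«`M(z,χ)φ = φ′`»: `φ′` a `χʷ`-section and `∫_{N(𝔸)} f_z(w₀ v g) dν(v) = f′_{1−z}(g)` for all `g`) — the textbook constant term `E_B(φ, z) = φ_z + M(z, χ)φ_{1−z}` of the `χ`-Eisenstein
series of `U(1,1)`, second summand in `I(χʷ‖·‖^{1−z})` (★ `flatSectionU_borel_mul_of_isChiSection` at `reflectChar c χ`). [cite: MoeglinWaldspurger1995, II.1.7] [cite: GelbartRogawski1991, §3.1] -/
theorem borelConstantTerm_chiEisenstein_cm_two_of_hasReflectedIntertwining (ν : Measure ↥(adelicUnipotent (↥(maximalRealSubfield L)) L (IsCMField.complexConj L) 2)) [ν.IsHaarMeasure]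
    {𝓕 : Set ↥(adelicUnipotent (↥(maximalRealSubfield L)) L (IsCMField.complexConj L) 2)} (h𝓕N : IsFundamentalDomain ↥(rationalUnipotent (↥(maximalRealSubfield L)) L (IsCMField.complexConj L) 2) 𝓕 ν) (h𝓕c : IsCompact (closure 𝓕))
    {χ : HeckeCharacter L} {φ φ' : (quasiSplit (↥(maximalRealSubfield L)) L (IsCMField.complexConj L) 2).Adelic → ℂ} (hφ : IsChiSection χ φ) (hφc : Continuous φ) {M : ℝ} (hφM : ∀ x, ‖φ x‖ ≤ M)
    {z : ℂ} (hz : 1 < z.re) (hM : HasReflectedIntertwining χ ν φ φ' z) (g : (quasiSplit (↥(maximalRealSubfield L)) L (IsCMField.complexConj L) 2).Adelic) :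
    borelConstantTerm ν 𝓕 (eisensteinSeriesU (flatSectionU φ z)) g = flatSectionU φ z g + ((ν 𝓕).toReal⁻¹ : ℝ) • flatSectionU φ' (1 - z) g := by
  rw [borelConstantTerm_chiEisenstein_cm_two L ν h𝓕N h𝓕c hφ hφc hφM hz g, hM.integral_eq g]

/-- **`E_B(f_z)(g) = f_z(g) + (ν𝓕)⁻¹ · f′_{1−z}(g)`** — §3 in the `ℂ`-multiplicative spelling of ★ `borelConstantTerm_sphericalEisenstein_cm_two` (`(ν𝓕)⁻¹` cast to `ℂ`), the shape the
Fourier ∕ continuation layers consume. [cite: MoeglinWaldspurger1995, II.1.7] [cite: GelbartRogawski1991, §3.1] -/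
theorem borelConstantTerm_chiEisenstein_cm_two_eq_add_mul (ν : Measure ↥(adelicUnipotent (↥(maximalRealSubfield L)) L (IsCMField.complexConj L) 2)) [ν.IsHaarMeasure]
    {𝓕 : Set ↥(adelicUnipotent (↥(maximalRealSubfield L)) L (IsCMField.complexConj L) 2)} (h𝓕N : IsFundamentalDomain ↥(rationalUnipotent (↥(maximalRealSubfield L)) L (IsCMField.complexConj L) 2) 𝓕 ν) (h𝓕c : IsCompact (closure 𝓕))
    {χ : HeckeCharacter L} {φ φ' : (quasiSplit (↥(maximalRealSubfield L)) L (IsCMField.complexConj L) 2).Adelic → ℂ} (hφ : IsChiSection χ φ) (hφc : Continuous φ) {M : ℝ} (hφM : ∀ x, ‖φ x‖ ≤ M)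
    {z : ℂ} (hz : 1 < z.re) (hM : HasReflectedIntertwining χ ν φ φ' z) (g : (quasiSplit (↥(maximalRealSubfield L)) L (IsCMField.complexConj L) 2).Adelic) :
    borelConstantTerm ν 𝓕 (eisensteinSeriesU (flatSectionU φ z)) g = flatSectionU φ z g + ((((ν 𝓕).toReal⁻¹ : ℝ)) : ℂ) * flatSectionU φ' (1 - z) g := by
  rw [borelConstantTerm_chiEisenstein_cm_two_of_hasReflectedIntertwining L ν h𝓕N h𝓕c hφ hφc hφM hz hM g, Complex.real_smul]

end Summit.HodgeConjecture.HodgeConjecture.Cruxes.H413.K2E1ChiEisensteinConstantTermCMTwo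

end
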